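import Mathlib.Algebra.MvPolynomial.Funext
import Mathlib.Algebra.MvPolynomial.Equiv
import Mathlib.Analysis.Complex.ReImTopology
import Mathlib.Analysis.Complex.Polynomial.GaussLucas
import Mathlib.Topology.Algebra.MvPolynomial
import Mathlib.Topology.UniformSpace.HeineCantor
import Literature.Analysis.Complex.Hurwitz
import Literature.Combinatorics.StablePolynomials.Basic
import HarnessLib

/-!
# Stable polynomials: limits, real specialisation, leading coefficients and `∂ᵢ`

Companion of `Literature/Combinatorics/StablePolynomials/Basic.lean` (which defines
`IsUpperHalfPlaneStable p :↔ ∀ z, (∀ i, 0 < Im (z i)) → p(z) ≠ 0`, Borcea–Brändén's "stable",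
and proves the closure properties that need no analysis). This file supplies the closure
properties that rest on **Hurwitz's theorem** — here the tree's one-variable
`Complex.hurwitz_eqOn_zero_or_forall_ne_zero` applied along complex lines — and on Mathlib's
**Gauss–Lucas theorem** `Polynomial.rootSet_derivative_subset_convexHull_rootSet`
(Wagner, *Multivariate stable polynomials*, Bull. AMS 48 (2011), §2: Hurwitz's Theorem and
Lemma 2.4 (d), (f); Borcea–Brändén, Invent. Math. 177 (2009), Thm. 1.6 and Lemma 1.7 (1);
Brändén, Adv. Math. 216 (2007), Prop. 3.3). Since the zero polynomial is not stable, every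
conclusion reads "`= 0 ∨` stable".

## Main results (namespace `Literature.Combinatorics.StablePolynomials`)

* `exists_eval_ne_zero` — a nonzero polynomial does not vanish identically on `H^σ`
  (`MvPolynomial.funext_set`; any index type).
* `isUpperHalfPlaneStable_of_tendstoLocallyUniformlyOn` — **multivariate Hurwitz for stability**:
  a nonzero `p` whose evaluation map is the locally uniform limit on `H^σ` of those of
  frequently-stable polynomials is stable. Proof: a zero `z₀ ∈ H^σ` and a non-zero `z₁ ∈ H^σ` of
  `p` span a complex line meeting `H^σ` in a convex open set `U ∋ 0, 1`; apply the one-variable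
  Hurwitz theorem on `U`.
* `eq_zero_or_isUpperHalfPlaneStable_of_mem_closure` — continuous-family form: if
  `(a, z) ↦ (P a)(z)` is jointly continuous and `P a` is stable for `a ∈ s`, then `P q` is `0` or
  stable for `q ∈ closure s` (locally uniform convergence from compactness,
  `IsCompact.mem_uniformity_of_prod`).
* `eq_zero_or_isUpperHalfPlaneStable_of_tendsto_coeff` — coefficientwise form ("limits of stable
  polynomials of bounded degree are stable or zero"): supports eventually in a finite set `D`,
  coefficients converge.
* `IsUpperHalfPlaneStable.specialize_of_im_nonneg` / `.specialize_real` — specialising one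
  variable at a point of the CLOSED upper half-plane gives `0` or a stable polynomial
  (Wagner Lemma 2.4 (d); Borcea–Brändén Lemma 1.7 (1)).
* `IsUpperHalfPlaneStable.leadingCoeff_optionEquivLeft` — the leading coefficient in a
  distinguished variable (index type `Option τ`, via `MvPolynomial.optionEquivLeft`) of a stable
  polynomial is stable (Wagner, proof of Lemma 2.4 (f)).
* `IsUpperHalfPlaneStable.pderiv_none`, `.pderiv`, `.iterate_pderiv`, `.foldr_pderiv` —
  **`∂ᵢ` preserves stability**: `∂ᵢ p = 0 ∨` stable (Wagner Lemma 2.4 (f); Brändén 2007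
  Prop. 3.3), by Gauss–Lucas in the variable `zᵢ` plus the leading-coefficient lemma for the
  degenerate fibres; general `σ` is reduced to `Option {j // j ≠ i}` by renaming.
* helpers: `IsUpperHalfPlaneStable.rename` (any map of variables; Wagner Lemma 2.4 (a),(c)),
  `isUpperHalfPlaneStable_rename_equiv_iff`, `eval_bind₁_update`, `isOpen_upperHalfSpace`,
  `differentiable_eval_line`, `convex_linePreimage`, `optionEquivLeft_pderiv_none`.

Stability of all elementary symmetric polynomials is in `ElementarySymmetric.lean`.

## References

* D. G. Wagner, *Multivariate stable polynomials: theory and applications*, Bull. Amer. Math.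
  Soc. 48 (2011) 53–84 (arXiv:0911.3569), §2 (Hurwitz's Theorem; Lemma 2.4). [Wagner2011]
* J. Borcea, P. Brändén, *The Lee–Yang and Pólya–Schur programs. I*, Invent. Math. 177 (2009)
  541–569, §1 (Thm. 1.6 Hurwitz; Lemma 1.7). [BorceaBranden2009]
* P. Brändén, *Polynomials with the half-plane property and matroid theory*, Adv. Math. 216
  (2007), Prop. 3.3 (`∂` preserves `H`-stability). [Branden2007]
* J. B. Conway, *Functions of one complex variable I*, VII.2.5 (Hurwitz). [Conway1978]
-/

noncomputable section

open scoped BigOperators ComplexConjugate Topology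
open MvPolynomial Filter Set

namespace Literature.Combinatorics.StablePolynomials

variable {σ τ : Type*}

/-! ### Nonvanishing somewhere; the open set `H^σ` -/

/-- A nonzero complex polynomial does not vanish identically on `H^σ` (each factor `H` of the
box is infinite; `MvPolynomial.funext_set`). [folklore] -/
theorem exists_eval_ne_zero {p : MvPolynomial σ ℂ} (hp : p ≠ 0) :
    ∃ z : σ → ℂ, (∀ i, 0 < (z i).im) ∧ eval z p ≠ 0 := by
  by_contra h
  push Not at h
  refine hp (MvPolynomial.funext_set (fun _ : σ => {w : ℂ | 0 < w.im}) (fun _ => ?_) ?_)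
  · refine Set.infinite_of_injective_forall_mem (f := fun n : ℕ => (n : ℂ) + Complex.I)
      (fun a b hab => ?_) (fun n => by simp)
    have := congrArg Complex.re hab
    simpa using this
  · intro x hx
    rw [map_zero]
    exact h x fun i => hx i (Set.mem_univ i)

/-- Evaluating the specialisation `zᵢ := w` is evaluating at the updated point. [folklore] -/
theorem eval_bind₁_update [DecidableEq σ] {R : Type*} [CommSemiring R] (p : MvPolynomial σ R)
    (i : σ) (w : R) (z : σ → R) :
    eval z (bind₁ (Function.update X i (C w)) p) = eval (Function.update z i w) p := by
  have hfun : (fun j => eval z (Function.update X i (C w) j)) = Function.update z i w := by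
    funext j
    rcases eq_or_ne j i with rfl | hji
    · simp
    · simp [Function.update_of_ne hji]
  rw [show eval z (bind₁ (Function.update X i (C w)) p) =
      eval (fun j => eval z (Function.update X i (C w) j)) p from eval₂Hom_bind₁ _ _ _ _, hfun]

/-- Renaming variables along any map preserves stability. [cite: Wagner2011, Lemma 2.4 (a),(c)] -/
theorem IsUpperHalfPlaneStable.rename {p : MvPolynomial σ ℂ} (hp : IsUpperHalfPlaneStable p)
    (k : σ → τ) : IsUpperHalfPlaneStable (MvPolynomial.rename k p) := fun z hz => by
  rw [eval_rename]
  exact hp _ fun i => hz (k i)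

/-- Stability is invariant under renaming along an equivalence. [folklore] -/
theorem isUpperHalfPlaneStable_rename_equiv_iff {p : MvPolynomial σ ℂ} (e : σ ≃ τ) :
    IsUpperHalfPlaneStable (MvPolynomial.rename e p) ↔ IsUpperHalfPlaneStable p := by
  refine ⟨fun h => ?_, fun h => h.rename e⟩
  have := h.rename e.symm
  rwa [rename_rename, e.symm_comp_self, rename_id] at this

/-- The product of open upper half-planes `H^σ` is open (finitely many variables). [folklore] -/
theorem isOpen_upperHalfSpace [Finite σ] : IsOpen {z : σ → ℂ | ∀ i, 0 < (z i).im} := by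
  have : {z : σ → ℂ | ∀ i, 0 < (z i).im} = Set.pi Set.univ (fun _ => {w : ℂ | 0 < w.im}) := by
    ext z; simp
  rw [this]
  exact isOpen_set_pi Set.finite_univ fun i _ => isOpen_lt continuous_const Complex.continuous_im

/-! ### Limits of stable polynomials (multivariate Hurwitz along complex lines) -/

/-- Evaluation of a polynomial along a complex line `s ↦ z₀ + s c` is an entire function of `s`.
[folklore] -/
theorem differentiable_eval_line (q : MvPolynomial σ ℂ) (z₀ c : σ → ℂ) :
    Differentiable ℂ fun s : ℂ => eval (fun i => z₀ i + s * c i) q := by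
  induction q using MvPolynomial.induction_on with
  | C a => simp
  | add p q hp hq => simp only [map_add]; exact hp.add hq
  | mul_X p i hp => simp only [map_mul, eval_X]; exact hp.mul (by fun_prop)

/-- The parameter set of a complex line inside `H^σ` is convex. [folklore] -/
theorem convex_linePreimage (z₀ c : σ → ℂ) :
    Convex ℝ {s : ℂ | ∀ i, 0 < (z₀ i + s * c i).im} := by
  have h : {s : ℂ | ∀ i, 0 < (z₀ i + s * c i).im} =
      ⋂ i, {s : ℂ | -(z₀ i).im < (fun s : ℂ => (s * c i).im) s} := by
    ext s
    simp only [Set.mem_setOf_eq, Set.mem_iInter, Complex.add_im]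
    exact forall_congr' fun i => by constructor <;> intro h <;> linarith
  rw [h]
  refine convex_iInter fun i => convex_halfSpace_gt ⟨fun x y => ?_, fun r x => ?_⟩ _
  · simp [add_mul]
  · simp [mul_assoc, Complex.mul_im]

/-- **Limits of stable polynomials (multivariate Hurwitz).** If the evaluation maps of the
polynomials `F n` converge locally uniformly on `H^σ` to that of `p` along a non-trivial filter,
and `F n` is stable frequently, then `p` is stable unless `p = 0`. Proof (Hurwitz along complex
lines, using the tree's one-variable `Complex.hurwitz_eqOn_zero_or_forall_ne_zero`): a zero
`z₀ ∈ H^σ` of `p` and a point `z₁ ∈ H^σ` with `p(z₁) ≠ 0` span a complex line meeting `H^σ` in an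
open convex set `U ∋ 0, 1`; on `U` the restrictions of the `F n` are zero-free holomorphic and
converge locally uniformly to the restriction of `p`, which vanishes at `0` but not at `1`.
[cite: Wagner2011, §2 (Hurwitz's Theorem and the sentence after it)] -/
theorem isUpperHalfPlaneStable_of_tendstoLocallyUniformlyOn [Finite σ] {ι : Type*}
    {l : Filter ι} [l.NeBot] {F : ι → MvPolynomial σ ℂ} {p : MvPolynomial σ ℂ}
    (hF : ∃ᶠ n in l, IsUpperHalfPlaneStable (F n))
    (hlim : TendstoLocallyUniformlyOn (fun n z => eval z (F n)) (fun z => eval z p) l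
      {z : σ → ℂ | ∀ i, 0 < (z i).im})
    (hp : p ≠ 0) : IsUpperHalfPlaneStable p := by
  intro z₀ hz₀ h0
  obtain ⟨z₁, hz₁, h1⟩ := exists_eval_ne_zero hp
  let ℓ : ℂ → σ → ℂ := fun s i => z₀ i + s * (z₁ i - z₀ i)
  have hℓ : Continuous ℓ := continuous_pi fun i => by fun_prop
  let U : Set ℂ := {s | ∀ i, 0 < (z₀ i + s * (z₁ i - z₀ i)).im}
  have hU : IsOpen U := isOpen_upperHalfSpace.preimage hℓ
  have hU' : IsPreconnected U := (convex_linePreimage z₀ fun i => z₁ i - z₀ i).isPreconnected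
  have h0U : (0 : ℂ) ∈ U := fun i => by simpa using hz₀ i
  have h1U : (1 : ℂ) ∈ U := fun i => by simpa using hz₁ i
  have hlim' : TendstoLocallyUniformlyOn (fun n s => eval (ℓ s) (F n)) (fun s => eval (ℓ s) p)
      l U :=
    hlim.comp ℓ (fun s hs => hs) hℓ.continuousOn
  have hfreq : ∃ᶠ n in l, ∀ s ∈ U, eval (ℓ s) (F n) ≠ 0 :=
    hF.mono fun n hn s hs => hn _ hs
  have hdiff : ∀ᶠ n in l, DifferentiableOn ℂ (fun s => eval (ℓ s) (F n)) U :=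
    Eventually.of_forall fun n => (differentiable_eval_line (F n) z₀ _).differentiableOn
  rcases Complex.hurwitz_eqOn_zero_or_forall_ne_zero hU hU' hdiff hlim' hfreq with h | h
  · refine h1 ?_
    have := h h1U
    simpa [ℓ] using this
  · refine h 0 h0U ?_
    simpa [ℓ] using h0

/-- **Limits of stable polynomials, continuous-family form.** Let `P : α → MvPolynomial σ ℂ` be a
family whose evaluation `(a, z) ↦ P a (z)` is jointly continuous, stable for every parameter
`a ∈ s`. Then at every `q` in the closure of `s`, `P q` is `0` or stable. (Joint continuity gives
locally uniform convergence on `H^σ` along `𝓝[s] q` by compactness; then the previous theorem.)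
[cite: Wagner2011, §2 (Hurwitz's Theorem)] -/
theorem eq_zero_or_isUpperHalfPlaneStable_of_mem_closure [Finite σ] {α : Type*}
    [TopologicalSpace α] {P : α → MvPolynomial σ ℂ}
    (hP : Continuous fun az : α × (σ → ℂ) => eval az.2 (P az.1))
    {s : Set α} (hs : ∀ a ∈ s, IsUpperHalfPlaneStable (P a)) {q : α} (hq : q ∈ closure s) :
    P q = 0 ∨ IsUpperHalfPlaneStable (P q) := by
  by_cases hPq : P q = 0
  · exact Or.inl hPq
  refine Or.inr ?_
  haveI : (𝓝[s] q).NeBot := mem_closure_iff_nhdsWithin_neBot.1 hq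
  have hfreq : ∃ᶠ a in 𝓝[s] q, IsUpperHalfPlaneStable (P a) :=
    (eventually_mem_nhdsWithin.mono hs).frequently
  refine isUpperHalfPlaneStable_of_tendstoLocallyUniformlyOn hfreq ?_ hPq
  haveI : LocallyCompactSpace (σ → ℂ) := inferInstance
  rw [tendstoLocallyUniformlyOn_iff_forall_isCompact isOpen_upperHalfSpace]
  intro K _ hK
  rw [Metric.tendstoUniformlyOn_iff]
  intro ε hε
  obtain ⟨v, hv, hvu⟩ := hK.mem_uniformity_of_prod (f := fun a z => eval z (P a))
    (s := insert q s) (hP.continuousOn) (Set.mem_insert q s) (Metric.dist_mem_uniformity hε)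
  have hv' : v ∈ 𝓝[s] q := nhdsWithin_mono q (Set.subset_insert q s) hv
  filter_upwards [hv'] with a ha z hz
  rw [dist_comm]
  exact hvu a ha z hz

/-- **Limits of stable polynomials, coefficientwise form** (the usual "multivariate Hurwitz for
polynomials of bounded degree"): if the `F n` have supports in a fixed finite set `D` eventually,
their coefficients converge to those of `p` (also supported in `D`), and `F n` is stable
frequently, then `p = 0` or `p` is stable. [cite: Wagner2011, §2 (sentence after Hurwitz's
Theorem)] -/
theorem eq_zero_or_isUpperHalfPlaneStable_of_tendsto_coeff [Finite σ] {ι : Type*} {l : Filter ι}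
    {F : ι → MvPolynomial σ ℂ} {p : MvPolynomial σ ℂ} (D : Finset (σ →₀ ℕ))
    (hFD : ∀ᶠ n in l, (F n).support ⊆ D) (hpD : p.support ⊆ D)
    (hcoeff : ∀ m ∈ D, Tendsto (fun n => coeff m (F n)) l (𝓝 (coeff m p)))
    (hF : ∃ᶠ n in l, IsUpperHalfPlaneStable (F n)) :
    p = 0 ∨ IsUpperHalfPlaneStable p := by
  classical
  -- the continuous family of all polynomials supported in `D`, parametrised by coefficients
  let P : ((σ →₀ ℕ) → ℂ) → MvPolynomial σ ℂ := fun c => ∑ m ∈ D, C (c m) * monomial m 1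
  have hPeval : ∀ c z, eval z (P c) = ∑ m ∈ D, c m * ∏ i ∈ m.support, z i ^ m i := by
    intro c z
    simp [P, map_sum, eval_monomial, Finsupp.prod]
  have hP : Continuous fun az : ((σ →₀ ℕ) → ℂ) × (σ → ℂ) => eval az.2 (P az.1) := by
    simp only [hPeval]
    refine continuous_finsetSum _ fun m _ => ?_
    refine ((continuous_apply m).comp continuous_fst).mul ?_
    exact continuous_finsetProd _ fun i _ => ((continuous_apply i).comp continuous_snd).pow _
  -- a polynomial supported in `D` is `P` of its coefficient function
  have hrep : ∀ q : MvPolynomial σ ℂ, q.support ⊆ D → P (fun m => coeff m q) = q := by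
    intro q hq
    have : q = ∑ m ∈ D, monomial m (coeff m q) := by
      rw [← Finset.sum_subset hq (fun m _ hm => by rw [notMem_support_iff.1 hm, monomial_zero]),
        ← q.as_sum]
    conv_rhs => rw [this]
    refine Finset.sum_congr rfl fun m _ => ?_
    rw [C_mul_monomial, mul_one]
  let s : Set ((σ →₀ ℕ) → ℂ) := {c | IsUpperHalfPlaneStable (P c)}
  have hlim : Tendsto (fun n => fun m => coeff m (F n)) l (𝓝 fun m => coeff m p) := by
    rw [tendsto_pi_nhds]
    intro m
    by_cases hm : m ∈ D
    · exact hcoeff m hm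
    · have hpm : coeff m p = 0 := notMem_support_iff.1 fun h => hm (hpD h)
      rw [hpm]
      refine tendsto_const_nhds.congr' ?_
      filter_upwards [hFD] with n hn
      exact (notMem_support_iff.1 fun h => hm (hn h)).symm
  have hfreq : ∃ᶠ n in l, (fun m => coeff m (F n)) ∈ s := by
    refine (hF.and_eventually hFD).mono fun n hn => ?_
    show IsUpperHalfPlaneStable (P fun m => coeff m (F n))
    rw [hrep (F n) hn.2]
    exact hn.1
  have hq : (fun m => coeff m p) ∈ closure s := mem_closure_of_frequently_of_tendsto hfreq hlim
  have := eq_zero_or_isUpperHalfPlaneStable_of_mem_closure hP (fun c hc => hc) hq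
  rwa [hrep p hpD] at this

/-! ### Specialisation at points of the closed upper half-plane -/

/-- **Specialisation in the closed upper half-plane** (Wagner, Lemma 2.4 (d)): setting `zᵢ := w`
with `Im w ≥ 0` in a stable polynomial gives `0` or a stable polynomial. For `Im w > 0` see
`IsUpperHalfPlaneStable.specialize` (no degenerate case); for `Im w = 0` this is the limit
`ε → 0⁺` of the specialisations at `w + iε`. [cite: Wagner2011, Lemma 2.4 (d)] -/
theorem IsUpperHalfPlaneStable.specialize_of_im_nonneg [Finite σ] [DecidableEq σ]
    {p : MvPolynomial σ ℂ} (hp : IsUpperHalfPlaneStable p) (i : σ) {w : ℂ} (hw : 0 ≤ w.im) :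
    bind₁ (Function.update X i (C w)) p = 0 ∨
      IsUpperHalfPlaneStable (bind₁ (Function.update X i (C w)) p) := by
  let P : ℂ → MvPolynomial σ ℂ := fun a => bind₁ (Function.update X i (C a)) p
  have hP : Continuous fun az : ℂ × (σ → ℂ) => eval az.2 (P az.1) := by
    simp only [P, eval_bind₁_update]
    exact (MvPolynomial.continuous_eval (p := p)).comp (continuous_snd.update i continuous_fst)
  have hs : ∀ a ∈ {a : ℂ | 0 < a.im}, IsUpperHalfPlaneStable (P a) := fun a ha => hp.specialize i ha
  have hq : w ∈ closure {a : ℂ | 0 < a.im} := by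
    rw [Complex.closure_setOf_lt_im]
    exact hw
  exact eq_zero_or_isUpperHalfPlaneStable_of_mem_closure hP hs hq

/-- **Specialisation at a real point**: `p(…, zᵢ := x, …)` is `0` or stable for real `x`.
[cite: Wagner2011, Lemma 2.4 (d)] -/
theorem IsUpperHalfPlaneStable.specialize_real [Finite σ] [DecidableEq σ]
    {p : MvPolynomial σ ℂ} (hp : IsUpperHalfPlaneStable p) (i : σ) (x : ℝ) :
    bind₁ (Function.update X i (C (x : ℂ))) p = 0 ∨
      IsUpperHalfPlaneStable (bind₁ (Function.update X i (C (x : ℂ))) p) :=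
  hp.specialize_of_im_nonneg i (by simp)

/-! ### One distinguished variable: leading coefficient and `∂` (index type `Option τ`) -/

section OptionVar

variable [Fintype τ]

omit [Fintype τ] in
/-- A point of `ℂ^{Option τ}` is `Option.elim` of its `none`- and `some`-coordinates.
[folklore] -/
theorem eq_optionElim (z : Option τ → ℂ) : z = fun x => Option.elim x (z none) fun j => z (some j) := by
  funext x; cases x <;> rfl

omit [Fintype τ] in
/-- `optionEquivLeft` turns `∂/∂z_{none}` into the derivative of the univariate polynomial.
[folklore] -/
theorem optionEquivLeft_pderiv_none {R : Type*} [CommRing R] (f : MvPolynomial (Option τ) R) :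
    optionEquivLeft R τ (pderiv none f) = Polynomial.derivative (optionEquivLeft R τ f) := by
  induction f using MvPolynomial.induction_on with
  | C a => simp
  | add p q hp hq => simp [hp, hq]
  | mul_X p o hp =>
    rw [pderiv_mul, map_add, map_mul, map_mul, hp, map_mul, Polynomial.derivative_mul]
    cases o with
    | none => simp
    | some j => simp [pderiv_X_of_ne]

/-- **Leading coefficient** (Wagner, proof of Lemma 2.4 (f)): if `p` is stable then the leading
coefficient of `p` as a polynomial in the distinguished variable `z_{none}` — a polynomial in
the remaining variables `τ` — is stable. It is the limit `u → 0⁺` of the stable polynomials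
`(-iu)^d p(…, i/u)`, and it is nonzero. [cite: Wagner2011, Lemma 2.4 (f), proof] -/
theorem IsUpperHalfPlaneStable.leadingCoeff_optionEquivLeft {p : MvPolynomial (Option τ) ℂ}
    (hp : IsUpperHalfPlaneStable p) :
    IsUpperHalfPlaneStable (optionEquivLeft ℂ τ p).leadingCoeff := by
  set P := optionEquivLeft ℂ τ p with hPdef
  set d := P.natDegree with hd
  have hp0 : p ≠ 0 := by
    rintro rfl
    exact hp (fun _ => Complex.I) (fun _ => by simp) (map_zero _)
  have hP0 : P ≠ 0 := by simpa [hPdef] using hp0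
  -- the family `G u = ∑_k (-i u)^{d-k} P_k`, `G 0 = P_d`
  let G : ℝ → MvPolynomial τ ℂ := fun u =>
    ∑ k ∈ Finset.range (d + 1), C ((-Complex.I * u) ^ (d - k)) * P.coeff k
  have hGeval : ∀ u s, eval s (G u) =
      ∑ k ∈ Finset.range (d + 1), (-Complex.I * u) ^ (d - k) * eval s (P.coeff k) := by
    intro u s
    simp [G, map_sum]
  have hG0 : G 0 = P.leadingCoeff := by
    simp only [G]
    rw [Finset.sum_eq_single d, Polynomial.leadingCoeff, ← hd]
    · simp
    · intro k hk hkd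
      have hlt : k < d := lt_of_le_of_ne (Nat.lt_succ_iff.1 (Finset.mem_range.1 hk)) hkd
      simp [zero_pow (Nat.sub_ne_zero_of_lt hlt)]
    · simp
  have hGcont : Continuous fun us : ℝ × (τ → ℂ) => eval us.2 (G us.1) := by
    simp only [hGeval]
    refine continuous_finsetSum _ fun k _ => ?_
    refine Continuous.mul (by fun_prop) ?_
    exact (MvPolynomial.continuous_eval (p := P.coeff k)).comp continuous_snd
  -- for `u > 0`, `G u (s) = (-iu)^d · p(s, i/u)`
  have hGpos : ∀ u ∈ Set.Ioi (0 : ℝ), IsUpperHalfPlaneStable (G u) := by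
    intro u hu s hs
    have hu0 : (u : ℂ) ≠ 0 := by exact_mod_cast (ne_of_gt hu)
    have key : eval s (G u) =
        (-Complex.I * u) ^ d * eval (fun x => Option.elim x (Complex.I / u) s) p := by
      rw [optionEquivLeft_elim_eval, Polynomial.eval_map, ← hPdef,
        Polynomial.eval₂_eq_sum_range' (eval s)
          (show P.natDegree < d + 1 by rw [hd]; exact Nat.lt_succ_self _),
        hGeval, Finset.mul_sum]
      refine Finset.sum_congr rfl fun k hk => ?_
      have hkd : k ≤ d := Nat.lt_succ_iff.1 (Finset.mem_range.1 hk)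
      have h1 : (-Complex.I * u) * (Complex.I / u) = 1 := by
        calc (-Complex.I * u) * (Complex.I / u) = -(Complex.I * Complex.I) * (u * (u : ℂ)⁻¹) := by
              ring
          _ = 1 := by rw [Complex.I_mul_I, mul_inv_cancel₀ hu0]; ring
      have h2 : (-Complex.I * u) ^ d = (-Complex.I * u) ^ (d - k) * (-Complex.I * u) ^ k := by
        rw [← pow_add, Nat.sub_add_cancel hkd]
      rw [h2]
      calc (-Complex.I * u) ^ (d - k) * eval s (P.coeff k)
          = (-Complex.I * u) ^ (d - k) * ((-Complex.I * u) * (Complex.I / u)) ^ k *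
              eval s (P.coeff k) := by rw [h1, one_pow, mul_one]
        _ = (-Complex.I * u) ^ (d - k) * (-Complex.I * u) ^ k *
              (eval s (P.coeff k) * (Complex.I / ↑u) ^ k) := by
          rw [mul_pow]; ring
    rw [key]
    refine mul_ne_zero (pow_ne_zero _ (mul_ne_zero (neg_ne_zero.2 Complex.I_ne_zero) hu0)) ?_
    refine hp _ fun x => ?_
    cases x with
    | none => simpa [Complex.div_im] using hu
    | some j => simpa using hs j
  have hcl : (0 : ℝ) ∈ closure (Set.Ioi (0 : ℝ)) := by
    rw [closure_Ioi]
    exact Set.self_mem_Ici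
  rcases eq_zero_or_isUpperHalfPlaneStable_of_mem_closure hGcont hGpos hcl with h | h
  · exact absurd (hG0 ▸ h) (Polynomial.leadingCoeff_ne_zero.2 hP0)
  · rwa [hG0] at h

/-- **Differentiation preserves stability** (distinguished-variable form; Wagner, Lemma 2.4 (f);
Brändén 2007, Prop. 3.3): for stable `p`, `∂p/∂z_{none}` is `0` or stable. Proof as in Wagner:
fix the other variables `s ∈ H^τ`; the univariate `g(y) = p(y, s)` is zero-free on `H`; if
`deg g > 0`, Gauss–Lucas (`Polynomial.rootSet_derivative_subset_convexHull_rootSet`) puts the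
zeros of `g'` in the closed lower half-plane; if `deg g = 0` then the leading coefficient of `p`
in `z_{none}` vanishes at `s`, contradicting `leadingCoeff_optionEquivLeft` unless `p` is free
of `z_{none}`. [cite: Wagner2011, Lemma 2.4 (f)] -/
theorem IsUpperHalfPlaneStable.pderiv_none {p : MvPolynomial (Option τ) ℂ}
    (hp : IsUpperHalfPlaneStable p) :
    pderiv none p = 0 ∨ IsUpperHalfPlaneStable (pderiv none p) := by
  by_cases hq : pderiv none p = 0
  · exact Or.inl hq
  refine Or.inr fun z hz h0 => ?_
  set P := optionEquivLeft ℂ τ p with hPdef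
  let y₀ : ℂ := z none
  let s : τ → ℂ := fun j => z (some j)
  have hs : ∀ j, 0 < (s j).im := fun j => hz (some j)
  let g : Polynomial ℂ := P.map (eval s)
  have hg_eval : ∀ y, g.eval y = eval (fun x => Option.elim x y s) p := fun y =>
    (optionEquivLeft_elim_eval (R := ℂ) (S₁ := τ) s y p).symm
  have hg'_eval : ∀ y, g.derivative.eval y = eval (fun x => Option.elim x y s) (pderiv none p) := by
    intro y
    rw [optionEquivLeft_elim_eval, optionEquivLeft_pderiv_none, ← hPdef, Polynomial.derivative_map]
  have hg_ne : ∀ y : ℂ, 0 < y.im → g.eval y ≠ 0 := by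
    intro y hy
    rw [hg_eval]
    exact hp _ fun x => by cases x with
      | none => simpa using hy
      | some j => simpa using hs j
  have h0' : g.derivative.eval y₀ = 0 := by
    rw [hg'_eval, ← eq_optionElim z]
    exact h0
  by_cases hdeg : 0 < g.degree
  · -- Gauss–Lucas
    have hg'0 : g.derivative ≠ 0 := by
      intro h
      have := Polynomial.derivative_eq_zero.1 h
      exact (Polynomial.natDegree_pos_iff_degree_pos.2 hdeg).ne' this
    have hmem : y₀ ∈ g.derivative.rootSet ℂ := Polynomial.mem_rootSet.2 ⟨hg'0, by simpa using h0'⟩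
    have hconv : Convex ℝ {y : ℂ | y.im ≤ 0} :=
      convex_halfSpace_le ⟨fun _ _ => Complex.add_im _ _, fun c x => Complex.smul_im c x⟩ 0
    have hroots : g.rootSet ℂ ⊆ {y : ℂ | y.im ≤ 0} := by
      intro y hy
      rw [Polynomial.mem_rootSet] at hy
      by_contra hlt
      exact hg_ne y (lt_of_not_ge hlt) (by simpa using hy.2)
    have := convexHull_min hroots hconv
      (Polynomial.rootSet_derivative_subset_convexHull_rootSet hdeg hmem)
    exact absurd (hz none) (not_lt.2 this)
  · -- `g` is constant: all higher coefficients of `P` vanish at `s`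
    have hgC : g = Polynomial.C (g.coeff 0) := Polynomial.eq_C_of_degree_le_zero (not_lt.1 hdeg)
    by_cases hd : P.natDegree = 0
    · apply hq
      apply (optionEquivLeft ℂ τ).injective
      rw [optionEquivLeft_pderiv_none, ← hPdef, Polynomial.eq_C_of_natDegree_eq_zero hd,
        Polynomial.derivative_C, map_zero]
    · have hlead := hp.leadingCoeff_optionEquivLeft
      rw [← hPdef] at hlead
      refine hlead s hs ?_
      have : eval s P.leadingCoeff = g.coeff P.natDegree := by
        rw [Polynomial.leadingCoeff, Polynomial.coeff_map]
      rw [this, hgC, Polynomial.coeff_C, if_neg hd]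

end OptionVar

/-- **Differentiation preserves stability** (Wagner, Lemma 2.4 (f); Brändén 2007, Prop. 3.3;
Choe–Oxley–Sokal–Wagner): for a stable polynomial `p` in finitely many variables and any
variable `i`, `∂ᵢ p` is either `0` or stable. Reduced to the distinguished-variable form
`IsUpperHalfPlaneStable.pderiv_none` by renaming `σ ≃ Option {j // j ≠ i}`.
[cite: Wagner2011, Lemma 2.4 (f)] -/
theorem IsUpperHalfPlaneStable.pderiv [Fintype σ] [DecidableEq σ] {p : MvPolynomial σ ℂ}
    (hp : IsUpperHalfPlaneStable p) (i : σ) :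
    pderiv i p = 0 ∨ IsUpperHalfPlaneStable (pderiv i p) := by
  let e : σ ≃ Option {j // j ≠ i} := (Equiv.optionSubtypeNe i).symm
  have he : e i = none := Equiv.optionSubtypeNe_symm_self i
  have hq : IsUpperHalfPlaneStable (MvPolynomial.rename e p) := hp.rename e
  have key := hq.pderiv_none
  rw [← he, pderiv_rename e.injective, map_eq_zero_iff _ (rename_injective e e.injective),
    isUpperHalfPlaneStable_rename_equiv_iff] at key
  exact key

/-- Iterated partial derivatives of a stable polynomial are `0` or stable.
[cite: Wagner2011, Lemma 2.4 (f)] -/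
theorem IsUpperHalfPlaneStable.iterate_pderiv [Fintype σ] [DecidableEq σ] {p : MvPolynomial σ ℂ}
    (hp : IsUpperHalfPlaneStable p) (i : σ) (k : ℕ) :
    (MvPolynomial.pderiv i)^[k] p = 0 ∨ IsUpperHalfPlaneStable ((MvPolynomial.pderiv i)^[k] p) := by
  induction k with
  | zero => exact Or.inr hp
  | succ k ih =>
    rw [Function.iterate_succ_apply']
    rcases ih with h | h
    · exact Or.inl (by rw [h, map_zero])
    · exact h.pderiv i

/-- Mixed iterated partial derivatives `∂_{i₁} ⋯ ∂_{i_k} p` (along a list of variables) of a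
stable polynomial are `0` or stable — e.g. `∂^T p` for a set `T` of variables.
[cite: Wagner2011, Lemma 2.4 (f)] -/
theorem IsUpperHalfPlaneStable.foldr_pderiv [Fintype σ] [DecidableEq σ] {p : MvPolynomial σ ℂ}
    (hp : IsUpperHalfPlaneStable p) (l : List σ) :
    l.foldr (fun i q => MvPolynomial.pderiv i q) p = 0 ∨
      IsUpperHalfPlaneStable (l.foldr (fun i q => MvPolynomial.pderiv i q) p) := by
  induction l with
  | nil => exact Or.inr hp
  | cons i l ih =>
    rw [List.foldr_cons]
    rcases ih with h | h
    · exact Or.inl (by rw [h, map_zero])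
    · exact h.pderiv i

end Literature.Combinatorics.StablePolynomials

end
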